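/-
Copyright (c) 2026 the pub-hodgecm-mathlib formalisation cell (harness21).  Prover seat hodgecm-mathlib-K2E1-p13 (g2), Track B ∕ K2-LIT, h413 = `stmt-HodgeConjecture-24833`,
line `K2_E1_TraceFormulaBeta`, ROADCARD «5Res ENDGAME BY FAMILIES» (dealer K2E1-plan (g7) (244)): the CITABLE M1 HEAD — conj-symmetry `c(conj z; χ) = conj c(z; χ)` of the rank-one scattering
scalar of a SELF-DUAL UNITARY `χ` at level `K_max` over a CM extension `L∕L⁺`, assembled BY NAME from ★ FILE A, ★ htube assembly, ★ (S)+(H3), ★ (K)+(K∞), ★ (H2) FILE 1, Iwasawa ★.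
-/
import Summits.HodgeConjecture.HodgeConjecture.Theorems.K2E1ChiScatteringConjSymmetryTubeU2          -- ★ p860264 (this seat): `htube_of_godementScalar`; brings ★ FILE A (`apply_conj_eq_conj_apply_of_tube_of_poleSet`) and ★ (H2) FILES 1–2
import Summits.HodgeConjecture.HodgeConjecture.Theorems.K2E1ChiSectionGaloisTwistU2                   -- ★ p860352 (this seat): `conj_apply_eq_apply_galTwist_of_selfDual`
import Summits.HodgeConjecture.HodgeConjecture.Theorems.K2E1QuasiSplitGaloisTwistArchCompactU           -- ★ p860408 (this seat): `map_conjAdele_mem_standardMaximalCompactGL'`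
import Literature.NumberTheory.Automorphic.UnitaryGroupIwasawaAdelic                                   -- ★ `exists_mem_borelAdelic_mul_mem_standardMaximalCompactGL_cm`
import HarnessLib

/-!
# `K2E1ChiScatteringConjSymmetryM1CMTwo` — THE M1 HEAD: `c(conj z; χ) = conj c(z; χ)` FOR SELF-DUAL UNITARY `χ` AT LEVEL `K_max` OVER A CM EXTENSION, ASSEMBLED BY NAME

Track B ∕ K2-LIT, crux h413 = `stmt-HodgeConjecture-24833`, route of record `HCCMUnconditional`; cell `hodgecm-mathlib`, squad K2, ENGINE E1.  THEOREMS ONLY (no `def`, no `instance`,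
no `notation`, no `sorry`; default heartbeats); lane `--supports stmt-HodgeConjecture-24833 --as helper` (count-neutral).  The CM pair `(L⁺, L, c)`, `N = 2` (= `cmDatum L 2 J₂` by `rfl`).

THE MATHEMATICS ([MoeglinWaldspurger1995, II.1.7, IV.1.10]; [Langlands1976, §7]; [BorelJacquet1979, §4.1]).  For a self-dual (`χʷ = χ`) unitary Hecke character `χ` of `L` and a
`χ`-section `φ` that is right-`K_max`-invariant with `φ(1) ∈ ℝ`: §1 **`hreal_cm`** `conj ∘ φ = φ ∘ c_G` for the Galois twist `c_G` (★ (S)+(H3) with the Iwasawa decomposition ★ and the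
`c`-stability of `K_max` ★ (K)+(K∞)); §2 **`htube_cm`** the Godement-range scalar `s(z) = r·φ′(1)⁻¹·∫_{N(𝔸)} f_z^φ(w₀ v) dν` (`ν` inversion-invariant, `r ∈ ℝ`, `φ′(1) ∈ ℝ`) satisfies
`s(conj z) = conj s(z)` on `{1 < Re z}` (★ htube assembly); §3 **`chi_scattering_conj_symm_m1_cm_two`** hence, if `s` is analytic off a closed co-discrete `P ⊆ {Re ≤ 1}`,
`s(conj z) = conj s(z)` for `z, conj z ∉ P` (★ FILE A) — the `hconj`∕`hadj` letter of the (SD) Plancherel road, with remaining binders = DATA of the M1 datum only.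
HONEST LABEL: HC_CM is proved only modulo the 7 printed citations (2 remaining named inputs: hLiu418 = `stmt-HodgeConjecture-24832`, h413 = `stmt-HodgeConjecture-24833`) until rung 0
closes; this file asserts no named fact, closes no socket; count-neutral; letter-free up to the datum's data.
[cite: MoeglinWaldspurger1995, II.1.7 and IV.1.10] [cite: Langlands1976, §7] [cite: BorelJacquet1979, §4.1]

## References
* [MoeglinWaldspurger1995] C. Mœglin, J.-L. Waldspurger, *Spectral decomposition and Eisenstein series* (1995), II.1.7, IV.1.10.
* [Langlands1976] R. P. Langlands, *On the Functional Equations Satisfied by Eisenstein Series*, LNM 544 (1976), §7.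
* [BorelJacquet1979] A. Borel, H. Jacquet, *Automorphic forms and automorphic representations*, PSPM 33.1 (1979), §4.1.
-/

set_option autoImplicit false
set_option linter.dupNamespace false  -- the mandated namespace repeats the summit's segment (`HodgeConjecture.HodgeConjecture`)

noncomputable section

open NumberField IsDedekindDomain MeasureTheory Filter Topology
open scoped NNReal MatrixGroups ComplexConjugate
open Literature.NumberTheory.Automorphic Literature.NumberTheory.Automorphic.UnitaryGroup AdelicGroupData
open Literature.NumberTheory.GaloisRepresentations (HeckeCharacter)
open Summit.HodgeConjecture.HodgeConjecture.Cruxes.H413.K2E1BorelEisensteinU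
open Summit.HodgeConjecture.HodgeConjecture.Cruxes.H413.K2E1CharacterEisensteinU2Defs
open Summit.HodgeConjecture.HodgeConjecture.Cruxes.H413.K2E1QuasiSplitGaloisTwistU2
open Summit.HodgeConjecture.HodgeConjecture.Cruxes.H413.K2E1ChiScatteringConjSymmetryCMTwo (apply_conj_eq_conj_apply_of_tube_of_poleSet)
open Summit.HodgeConjecture.HodgeConjecture.Cruxes.H413.K2E1ChiScatteringConjSymmetryTubeU2 (htube_of_godementScalar)
open Summit.HodgeConjecture.HodgeConjecture.Cruxes.H413.K2E1ChiSectionGaloisTwistU2 (conj_apply_eq_apply_galTwist_of_selfDual)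
open Summit.HodgeConjecture.HodgeConjecture.Cruxes.H413.K2E1QuasiSplitGaloisTwistArchCompactU (map_conjAdele_mem_standardMaximalCompactGL')

namespace Summit.HodgeConjecture.HodgeConjecture.Cruxes.H413.K2E1ChiScatteringConjSymmetryM1CMTwo

variable (L : Type) [Field L] [NumberField L] [IsCMField L]

/-- **The Galois twist of `U(1,1)(𝔸_{L⁺})` exists** (★ `exists_galTwist` at the CM pair). [cite: MoeglinWaldspurger1995, I.1.4] -/
theorem exists_galTwist_cm : ∃ cG : (quasiSplit (↥(maximalRealSubfield L)) L (IsCMField.complexConj L) 2).Adelic →* (quasiSplit (↥(maximalRealSubfield L)) L (IsCMField.complexConj L) 2).Adelic,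
    ∀ g, adelicVal (↥(maximalRealSubfield L)) L (IsCMField.complexConj L) 2 _ (cG g) =
      Matrix.GeneralLinearGroup.map (conjAdele (↥(maximalRealSubfield L)) L (IsCMField.complexConj L)) (adelicVal (↥(maximalRealSubfield L)) L (IsCMField.complexConj L) 2 _ g) :=
  exists_galTwist (↥(maximalRealSubfield L)) L (IsCMField.complexConj L) 2

/-! ## §1 (hreal) for normalised right-`K_max`-invariant sections of a self-dual unitary `χ` -/

/-- **§1 `conj (φ g) = φ (c_G g)`** at the CM pair, for a right-`K_max`-invariant `χ`-section `φ` with `φ(1) ∈ ℝ`, `χ` self-dual unitary — Iwasawa ★ + (K)+(K∞) ★ + (S)+(H3) ★.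
[cite: MoeglinWaldspurger1995, I.2.17 and II.1.7] [cite: BorelJacquet1979, §4.1] -/
theorem hreal_cm {cG : (quasiSplit (↥(maximalRealSubfield L)) L (IsCMField.complexConj L) 2).Adelic →* (quasiSplit (↥(maximalRealSubfield L)) L (IsCMField.complexConj L) 2).Adelic}
    (hcG : ∀ g, adelicVal (↥(maximalRealSubfield L)) L (IsCMField.complexConj L) 2 _ (cG g) =
      Matrix.GeneralLinearGroup.map (conjAdele (↥(maximalRealSubfield L)) L (IsCMField.complexConj L)) (adelicVal (↥(maximalRealSubfield L)) L (IsCMField.complexConj L) 2 _ g))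
    {χ : HeckeCharacter L} (hsd : reflectChar (IsCMField.complexConj L) χ = χ) (hχ : χ.IsUnitary)
    {φ : (quasiSplit (↥(maximalRealSubfield L)) L (IsCMField.complexConj L) 2).Adelic → ℂ} (hφ : IsChiSection χ φ)
    (hφK : ∀ k : (quasiSplit (↥(maximalRealSubfield L)) L (IsCMField.complexConj L) 2).Adelic,
      adelicVal (↥(maximalRealSubfield L)) L (IsCMField.complexConj L) 2 _ k ∈ standardMaximalCompactGL 2 L → ∀ g, φ (g * k) = φ g)
    (hφ1 : conj (φ 1) = φ 1) :
    ∀ g, conj (φ g) = φ (cG g) := by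
  refine conj_apply_eq_apply_galTwist_of_selfDual (AlgEquiv.ext fun x => IsCMField.complexConj_apply_apply L x) hcG
    (K := {k | adelicVal (↥(maximalRealSubfield L)) L (IsCMField.complexConj L) 2 _ k ∈ standardMaximalCompactGL 2 L}) (fun g => ?_) (fun k hk => ?_) hsd hχ hφ
    (fun k hk g => hφK k hk g) hφ1
  · obtain ⟨b, hb, k, hk, rfl⟩ := exists_mem_borelAdelic_mul_mem_standardMaximalCompactGL_cm L (N := 2) g
    exact ⟨b, hb, k, hk, rfl⟩
  · show adelicVal (↥(maximalRealSubfield L)) L (IsCMField.complexConj L) 2 _ (cG k) ∈ standardMaximalCompactGL 2 L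
    rw [hcG]
    exact map_conjAdele_mem_standardMaximalCompactGL' (AlgEquiv.ext fun x => IsCMField.complexConj_apply_apply L x) hk

/-! ## §2 (htube) and §3 the M1 conj-symmetry head -/

/-- **§2 `s(conj z) = conj s(z)` ON THE TUBE `{1 < Re z}`** for the Godement-range scalar of a datum `(φ, φ′)` with `φ` as in §1 and `φ′(1) ∈ ℝ` (★ `htube_of_godementScalar` + §1).
[cite: MoeglinWaldspurger1995, II.1.7] [cite: Langlands1976, §7] -/
theorem htube_cm {cG : (quasiSplit (↥(maximalRealSubfield L)) L (IsCMField.complexConj L) 2).Adelic →* (quasiSplit (↥(maximalRealSubfield L)) L (IsCMField.complexConj L) 2).Adelic}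
    (hcG : ∀ g, adelicVal (↥(maximalRealSubfield L)) L (IsCMField.complexConj L) 2 _ (cG g) =
      Matrix.GeneralLinearGroup.map (conjAdele (↥(maximalRealSubfield L)) L (IsCMField.complexConj L)) (adelicVal (↥(maximalRealSubfield L)) L (IsCMField.complexConj L) 2 _ g))
    [MeasurableSpace (quasiSplit (↥(maximalRealSubfield L)) L (IsCMField.complexConj L) 2).Adelic] [BorelSpace (quasiSplit (↥(maximalRealSubfield L)) L (IsCMField.complexConj L) 2).Adelic]
    (ν : Measure ↥(adelicUnipotent (↥(maximalRealSubfield L)) L (IsCMField.complexConj L) 2)) [ν.IsInvInvariant] (r : ℝ)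
    {χ : HeckeCharacter L} (hsd : reflectChar (IsCMField.complexConj L) χ = χ) (hχ : χ.IsUnitary)
    {φ φ' : (quasiSplit (↥(maximalRealSubfield L)) L (IsCMField.complexConj L) 2).Adelic → ℂ} (hφ : IsChiSection χ φ)
    (hφK : ∀ k : (quasiSplit (↥(maximalRealSubfield L)) L (IsCMField.complexConj L) 2).Adelic,
      adelicVal (↥(maximalRealSubfield L)) L (IsCMField.complexConj L) 2 _ k ∈ standardMaximalCompactGL 2 L → ∀ g, φ (g * k) = φ g)
    (hφ1 : conj (φ 1) = φ 1) (hφ'1 : conj (φ' 1) = φ' 1) {s : ℂ → ℂ}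
    (hs : ∀ z : ℂ, 1 < z.re → s z = ((r : ℝ) : ℂ) * ((φ' 1)⁻¹ * ∫ v : ↥(adelicUnipotent (↥(maximalRealSubfield L)) L (IsCMField.complexConj L) 2), flatSectionU φ z
        ((quasiSplit (↥(maximalRealSubfield L)) L (IsCMField.complexConj L) 2).toAdelic (weylLongU (IsCMField.complexConj L : L →+* L)
          (rfl : (StdForm.antidiagonal 2).over L = (StdForm.antidiagonal 2).over L)) * ((v : (quasiSplit (↥(maximalRealSubfield L)) L (IsCMField.complexConj L) 2).Adelic) * 1)) ∂ν)) :
    ∀ z : ℂ, 1 < z.re → s (conj z) = conj (s z) :=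
  htube_of_godementScalar (AlgEquiv.ext fun x => IsCMField.complexConj_apply_apply L x) hcG ν r (hreal_cm L hcG hsd hχ hφ hφK hφ1) hφ'1 hs

/-- **§3 THE M1 HEAD — `s(conj z) = conj s(z)` OFF THE POLE SET** for the scattering scalar `s = c(·; χ)` of a self-dual unitary `χ` at level `K_max` over the CM pair: `s` analytic off a
closed co-discrete `P ⊆ {Re ≤ 1}` and given on the tube by the Godement-range formula of a normalised datum ⇒ `s(conj z) = conj s(z)` whenever `z, conj z ∉ P` (★ FILE A
`apply_conj_eq_conj_apply_of_tube_of_poleSet` + §2).  The `hconj`∕`hadj` letter of the (SD) Plancherel road at M1. [cite: MoeglinWaldspurger1995, IV.1.10] [cite: Langlands1976, §7] -/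
theorem chi_scattering_conj_symm_m1_cm_two
    {cG : (quasiSplit (↥(maximalRealSubfield L)) L (IsCMField.complexConj L) 2).Adelic →* (quasiSplit (↥(maximalRealSubfield L)) L (IsCMField.complexConj L) 2).Adelic}
    (hcG : ∀ g, adelicVal (↥(maximalRealSubfield L)) L (IsCMField.complexConj L) 2 _ (cG g) =
      Matrix.GeneralLinearGroup.map (conjAdele (↥(maximalRealSubfield L)) L (IsCMField.complexConj L)) (adelicVal (↥(maximalRealSubfield L)) L (IsCMField.complexConj L) 2 _ g))
    [MeasurableSpace (quasiSplit (↥(maximalRealSubfield L)) L (IsCMField.complexConj L) 2).Adelic] [BorelSpace (quasiSplit (↥(maximalRealSubfield L)) L (IsCMField.complexConj L) 2).Adelic]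
    (ν : Measure ↥(adelicUnipotent (↥(maximalRealSubfield L)) L (IsCMField.complexConj L) 2)) [ν.IsInvInvariant] (r : ℝ)
    {χ : HeckeCharacter L} (hsd : reflectChar (IsCMField.complexConj L) χ = χ) (hχ : χ.IsUnitary)
    {φ φ' : (quasiSplit (↥(maximalRealSubfield L)) L (IsCMField.complexConj L) 2).Adelic → ℂ} (hφ : IsChiSection χ φ)
    (hφK : ∀ k : (quasiSplit (↥(maximalRealSubfield L)) L (IsCMField.complexConj L) 2).Adelic,
      adelicVal (↥(maximalRealSubfield L)) L (IsCMField.complexConj L) 2 _ k ∈ standardMaximalCompactGL 2 L → ∀ g, φ (g * k) = φ g)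
    (hφ1 : conj (φ 1) = φ 1) (hφ'1 : conj (φ' 1) = φ' 1)
    {P : Set ℂ} {s : ℂ → ℂ} (hPc : IsClosed P) (hPcd : ∀ z₀ : ℂ, ∀ᶠ w in 𝓝[≠] z₀, w ∉ P) (hPre : ∀ z ∈ P, z.re ≤ 1) (hsan : ∀ z : ℂ, z ∉ P → AnalyticAt ℂ s z)
    (hs : ∀ z : ℂ, 1 < z.re → s z = ((r : ℝ) : ℂ) * ((φ' 1)⁻¹ * ∫ v : ↥(adelicUnipotent (↥(maximalRealSubfield L)) L (IsCMField.complexConj L) 2), flatSectionU φ z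
        ((quasiSplit (↥(maximalRealSubfield L)) L (IsCMField.complexConj L) 2).toAdelic (weylLongU (IsCMField.complexConj L : L →+* L)
          (rfl : (StdForm.antidiagonal 2).over L = (StdForm.antidiagonal 2).over L)) * ((v : (quasiSplit (↥(maximalRealSubfield L)) L (IsCMField.complexConj L) 2).Adelic) * 1)) ∂ν)) :
    ∀ z : ℂ, z ∉ P → conj z ∉ P → s (conj z) = conj (s z) :=
  apply_conj_eq_conj_apply_of_tube_of_poleSet hPc hPcd hPre hsan (htube_cm L hcG ν r hsd hχ hφ hφK hφ1 hφ'1 hs)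

end Summit.HodgeConjecture.HodgeConjecture.Cruxes.H413.K2E1ChiScatteringConjSymmetryM1CMTwo

end
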